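import Summits.KontsevichZagierPeriods.Zeta5Search.RVJetShift
import HarnessLib

/-!
# fam-rv 15.1 — `RVBellJet`: the Bell dictionary — jet data, and `T_{e(s)}` IS the common shift of the logarithmic jets

HONEST FRAMING: systematic search; no irrationality claim unless certified.  Pure algebra of truncated partial-fraction data
(six orders), valid for ARBITRARY residues `A`, pole orders `d ≤ 6` and jets `Λ`; nothing here concerns integrals, sizes,
denominators or irrationality; Δγ = 0.  This file supplies the dictionary that `RVJetShift` (14.2) deferred ("MEANING … dictionary
deferred to a later file").

## Content (all PROVED; no typed node)
* Part A — the truncated exponential Bell map `bellE Λ n = [uⁿ] exp(Σ_{k≥1} Λ_k u^k)` for `n ≤ 5` (explicit polynomials; `0` beyond the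
  six orders), its recursion `n·e_n = Σ_{j<n} (j+1)Λ_{j+1} e_{n-1-j}` (`bellE_rec`, the recursion used by the cell's exact scripts) and the
  CONVOLUTION LAW `e_n(Λ + s) = Σ_{k≤n} e_k(s) e_{n-k}(Λ)` (`bellE_add`: `exp` of a sum); `bellE_single_two` (`s = τ·δ₂` gives
  `(1,0,τ,0,τ²/2,0)`, the operator `exp(τ∂²)` of 14.2 Part A).
* Part B — JET DATA: the column of a pole of order `d` with residue `A` and jets `Λ`, `c_o = A·e_{d-1-o}(Λ)` (`o < d`), `0` above
  (`jetColumn`, `jetData`); **`jetOp_jetData`**: for `d_q ≤ 6` at every pole, `T_{bellE s}(jetData d A Λ) = jetData d A (Λ + s)` — the jet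
  operator of 14.2 with symbol `e(s)` is EXACTLY the simultaneous shift `Λ_k(q) ↦ Λ_k(q) + s_k` at every pole; hence the group law
  `jetOp_jetData_comp` and `jetShift2_jetData` (`exp(τ∂²)` = the common shift of the second jets by `τ`).
* Part C — consequences for the functionals of 14.2 on jet data under the common second-jet shift `Λ₂ ↦ Λ₂ + τ`:
  `rawSum_four_jetData_shift2` (`U` fixed), `rawSum_two_jetData_shift2` (`W ↦ W + τ·U`: `W` is AFFINE in the common second jet with slope
  `U`), `rawMinorQ_jetData_shift2` (`Q` fixed, no hypothesis) — the formal content of the "Λ-elimination" below.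

## Why the line wants this (gen 15; exact scripts `pub-zeta5-fam-rv/gen15/{rf15,jetsym15,vsym15}.py`, outputs `gen15/out/`)
On a uniform affine zone-C type `b(p) = (2p+δ₀; p+δ₁,…,p+δ₅; δ₆, δ₇)` the data of `R_{b(p)}` ARE jet data (residues `A_s`, jets
`λ_k(s) = Σ_a m(a)(−1)^{k+1}/(k(a−s)^k)`), and every ingredient EXCEPT the common even jet `Λ₂ = λ₂(s*)` is a rational function of `p`
(residue ratios and jet differences telescope; odd jets by the mirror formula).  By Part C, `U`, `U^core` are free of `Λ₂` and `W`, `W^core`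
are affine in it with slopes `U`, `U^core`, so `Q = U·W^core − U^core·W` and the deflated sum `D` are RATIONAL IN `p` — computed in closed
form for all 1,779 residual types of the `p₀ = 7` census (`jetsym15`: symbolic == recognised 1,779/1,779; 8,354 exact value checks at
`p ∈ {7,…,23}`), with the uniform outcome `v_p(D) = −2` for every type and every large generic prime (so the pivot law (PQ) of 14.1 on a type
is exactly `v_p(V) ≥ node + 2`, decided type by type by the companion `V`-side engine `vsym15`).  Those are exact computations about the
search's bookkeeping, recorded in the family notes; this file formalises only the dictionary they rest on.

Provenance: planner seat `planner-pub-zeta5-fam-rv-g15-0` (unit `pub-zeta5-fam-rv-g15`).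
-/

noncomputable section

open Finset

namespace Summit.KontsevichZagierPeriods.Zeta5Search.RVFlatGauge

/-! ## Part A — the truncated exponential Bell map -/

/-- `bellE Λ n = [uⁿ] exp(Σ_{k≥1} Λ_k u^k)` for `n ≤ 5` (the six orders of the cell), `0` for `n ≥ 6`.  `Λ 0` is never used. -/
def bellE (Λ : ℕ → ℚ) : ℕ → ℚ
  | 0 => 1
  | 1 => Λ 1
  | 2 => Λ 2 + Λ 1 ^ 2 / 2
  | 3 => Λ 3 + Λ 1 * Λ 2 + Λ 1 ^ 3 / 6
  | 4 => Λ 4 + Λ 1 * Λ 3 + Λ 2 ^ 2 / 2 + Λ 1 ^ 2 * Λ 2 / 2 + Λ 1 ^ 4 / 24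
  | 5 => Λ 5 + Λ 1 * Λ 4 + Λ 2 * Λ 3 + Λ 1 ^ 2 * Λ 3 / 2 + Λ 1 * Λ 2 ^ 2 / 2 + Λ 1 ^ 3 * Λ 2 / 6 + Λ 1 ^ 5 / 120
  | _ + 6 => 0

/-- `e₀ = 1`. -/
@[simp] theorem bellE_zero (Λ : ℕ → ℚ) : bellE Λ 0 = 1 := rfl

/-- Beyond the six orders the truncated map is `0`. -/
@[simp] theorem bellE_add_six (Λ : ℕ → ℚ) (n : ℕ) : bellE Λ (n + 6) = 0 := rfl

/-- The zero jet exponentiates to `(1,0,0,0,0,0)`. -/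
theorem bellE_null (n : ℕ) : bellE (fun _ => 0) n = if n = 0 then 1 else 0 := by
  rcases n with _ | _ | _ | _ | _ | _ | n <;> simp [bellE]

/-- THE RECURSION `n·e_n = Σ_{j<n} (j+1)·Λ_{j+1}·e_{n-1-j}` (`1 ≤ n ≤ 5`), i.e. `E' = (Σ kΛ_k u^{k-1})·E` coefficientwise — the
formula by which the cell's exact scripts (`logjet15.bell`) compute the jets. -/
theorem bellE_rec (Λ : ℕ → ℚ) {n : ℕ} (h1 : 1 ≤ n) (h5 : n ≤ 5) :
    (n : ℚ) * bellE Λ n = ∑ j ∈ range n, ((j : ℚ) + 1) * Λ (j + 1) * bellE Λ (n - 1 - j) := by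
  interval_cases n <;> simp [bellE, sum_range_succ] <;> ring

/-- **CONVOLUTION LAW** (`exp` of a sum is the product): `e_n(Λ + s) = Σ_{k ≤ n} e_k(s)·e_{n-k}(Λ)` on the six orders. -/
theorem bellE_add (Λ s : ℕ → ℚ) {n : ℕ} (h5 : n ≤ 5) :
    bellE (fun k => Λ k + s k) n = ∑ k ∈ range (n + 1), bellE s k * bellE Λ (n - k) := by
  interval_cases n <;> simp [bellE, sum_range_succ] <;> ring

/-- The symbol of the common SECOND-jet shift: `e(τ·δ₂) = (1, 0, τ, 0, τ²/2, 0)` — the operator `exp(τ∂²)` of 14.2 Part A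
(`jetOp_eq_jetShift2`). -/
theorem bellE_single_two (τ : ℚ) :
    bellE (fun k => if k = 2 then τ else 0) =
      fun k => if k = 0 then 1 else if k = 2 then τ else if k = 4 then τ ^ 2 / 2 else 0 := by
  funext n
  rcases n with _ | _ | _ | _ | _ | _ | n <;> simp [bellE]

/-! ## Part B — jet data and the dictionary -/

/-- The data column of ONE pole of order `d` with residue `A` and logarithmic jets `Λ`: `c_o = A·e_{d-1-o}(Λ)` for `o < d`
(the coefficient of `u^{-(o+1)}` in `u^{-d}·A·exp(Σ_k Λ_k u^k)`), `0` for `o ≥ d`. -/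
def jetColumn (d : ℕ) (A : ℚ) (Λ : ℕ → ℚ) (o : ℕ) : ℚ :=
  if o < d then A * bellE Λ (d - 1 - o) else 0

/-- Above the pole order the column vanishes. -/
theorem jetColumn_of_le {d o : ℕ} (h : d ≤ o) (A : ℚ) (Λ : ℕ → ℚ) : jetColumn d A Λ o = 0 := by
  simp [jetColumn, Nat.not_lt.2 h]

/-- A SIMPLE pole carries only its residue: column `(A, 0, 0, …)`. -/
theorem jetColumn_one (A : ℚ) (Λ : ℕ → ℚ) (o : ℕ) : jetColumn 1 A Λ o = if o = 0 then A else 0 := by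
  rcases o with _ | o <;> simp [jetColumn]

/-- The top entry of a column is the residue: `c_{d-1} = A`. -/
theorem jetColumn_top {d : ℕ} (hd : 1 ≤ d) (A : ℚ) (Λ : ℕ → ℚ) : jetColumn d A Λ (d - 1) = A := by
  simp [jetColumn, show d - 1 < d by omega]

/-- JET DATA: at pole `q`, order `d q`, residue `A q`, jets `Λ q`. -/
def jetData (d : ℕ → ℕ) (A : ℕ → ℚ) (Λ : ℕ → ℕ → ℚ) : ℕ → ℕ → ℚ := fun o q => jetColumn (d q) (A q) (Λ q) o

/-- One column under the jet operator with an exponential symbol: the shift of its jets (`d ≤ 6`). -/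
theorem jetOp_jetColumn {d : ℕ} (hd : d ≤ 6) (A : ℚ) (Λ s : ℕ → ℚ) (o q : ℕ) :
    jetOp (bellE s) (fun o' _ => jetColumn d A Λ o') o q = jetColumn d A (fun k => Λ k + s k) o := by
  rcases Nat.lt_or_ge o 6 with ho | ho
  · simp only [jetOp, if_pos ho, jetColumn]
    interval_cases d <;> interval_cases o <;> simp [sum_range_succ, bellE] <;> ring
  · simp [jetOp, jetColumn, show ¬o < 6 by omega, show ¬o < d by omega]

/-- **THE DICTIONARY.**  For pole orders `d_q ≤ 6`, the jet operator of 14.2 with exponential symbol `e(s)` acts on jet data as the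
SIMULTANEOUS SHIFT of every logarithmic jet at every pole: `T_{e(s)}(jetData d A Λ) = jetData d A (Λ + s)`. -/
theorem jetOp_jetData {d : ℕ → ℕ} (hd : ∀ q, d q ≤ 6) (A : ℕ → ℚ) (Λ : ℕ → ℕ → ℚ) (s : ℕ → ℚ) :
    jetOp (bellE s) (jetData d A Λ) = jetData d A (fun q k => Λ q k + s k) := by
  funext o q
  have h := jetOp_jetColumn (hd q) (A q) (Λ q) s o q
  simp only [jetOp, jetData] at h ⊢
  exact h

/-- GROUP LAW on jet data: shifting by `s'` then by `s` is shifting by `s' + s`. -/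
theorem jetOp_jetData_comp {d : ℕ → ℕ} (hd : ∀ q, d q ≤ 6) (A : ℕ → ℚ) (Λ : ℕ → ℕ → ℚ) (s s' : ℕ → ℚ) :
    jetOp (bellE s) (jetOp (bellE s') (jetData d A Λ)) = jetData d A (fun q k => Λ q k + (s' k + s k)) := by
  rw [jetOp_jetData hd, jetOp_jetData hd]
  simp only [add_assoc]

/-- `exp(τ∂²)` of 14.2 Part A on jet data = the common shift of the SECOND jets by `τ`. -/
theorem jetShift2_jetData {d : ℕ → ℕ} (hd : ∀ q, d q ≤ 6) (A : ℕ → ℚ) (Λ : ℕ → ℕ → ℚ) (τ : ℚ) :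
    jetShift2 τ (jetData d A Λ) = jetData d A (fun q k => Λ q k + if k = 2 then τ else 0) := by
  rw [← jetOp_jetData hd, bellE_single_two, jetOp_eq_jetShift2]

/-! ## Part C — the functionals on jet data under the common second-jet shift -/

/-- `U` (the top functional) does not see the common second jet. -/
theorem rawSum_four_jetData_shift2 {d : ℕ → ℕ} (hd : ∀ q, d q ≤ 6) (N : ℕ) (A : ℕ → ℚ) (Λ : ℕ → ℕ → ℚ) (τ : ℚ) :
    rawSum N 4 (jetData d A (fun q k => Λ q k + if k = 2 then τ else 0)) = rawSum N 4 (jetData d A Λ) := by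
  rw [← jetShift2_jetData hd, rawSum_four_jetShift2]

/-- **`W` is AFFINE in the common second jet with slope `U`**: `W(Λ₂ + τ) = W(Λ₂) + τ·U`. -/
theorem rawSum_two_jetData_shift2 {d : ℕ → ℕ} (hd : ∀ q, d q ≤ 6) (N : ℕ) (A : ℕ → ℚ) (Λ : ℕ → ℕ → ℚ) (τ : ℚ) :
    rawSum N 2 (jetData d A (fun q k => Λ q k + if k = 2 then τ else 0)) =
      rawSum N 2 (jetData d A Λ) + τ * rawSum N 4 (jetData d A Λ) := by
  rw [← jetShift2_jetData hd, rawSum_two_jetShift2]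

/-- The `Q`-minor of jet data is INDEPENDENT of the common second jet (no hypothesis; 14.2 `rawMinorQ_jetShift2`). -/
theorem rawMinorQ_jetData_shift2 {d : ℕ → ℕ} (hd : ∀ q, d q ≤ 6) (N : ℕ) (n : ℚ) (A : ℕ → ℚ) (Λ : ℕ → ℕ → ℚ) (τ : ℚ) :
    rawMinorQ N n (jetData d A (fun q k => Λ q k + if k = 2 then τ else 0)) = rawMinorQ N n (jetData d A Λ) := by
  rw [← jetShift2_jetData hd, rawMinorQ_jetShift2]

/-- The same for a GENERAL common shift `s` with `s₁ = s₃ = 0` … no: for a general `s`, `Q` picks up the factor `e₀(s)² = 1` as soon as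
the odd symbol entries vanish — `e₁(s) = s₁`, `e₃(s) = s₃ + s₁s₂ + s₁³/6`; in particular every EVEN common shift (`s₁ = s₃ = s₅ = 0`)
fixes `Q` of arbitrary jet data. -/
theorem rawMinorQ_jetData_evenShift {d : ℕ → ℕ} (hd : ∀ q, d q ≤ 6) (N : ℕ) (n : ℚ) (A : ℕ → ℚ) (Λ : ℕ → ℕ → ℚ)
    (s : ℕ → ℚ) (h1 : s 1 = 0) (h3 : s 3 = 0) :
    rawMinorQ N n (jetData d A (fun q k => Λ q k + s k)) = rawMinorQ N n (jetData d A Λ) := by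
  rw [← jetOp_jetData hd, rawMinorQ_jetOp_even N n (bellE s) _ (by simp [bellE, h1]) (by simp [bellE, h1, h3])]
  simp [bellE]

end Summit.KontsevichZagierPeriods.Zeta5Search.RVFlatGauge

end
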